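import Summits.ResolutionOfSingularities.ResolutionOfSingularities.Theorems.LossEntryW06
import HarnessLib

/-!
# LossEntryW07 — walk plumbing of the loss→entry law `LawLossEntry`, part 7/11

decomp-res-lens-3, gen 29 (HOME/decomp-res-lens-3/g29/NODE-g29.md).  TOOL at 0 toward the residual item
stmt-ResolutionOfSingularities-27367 (`WallCut.NoLossyStrictTailsDeep` ⟸ `LossEpisode.LawLossEntry`).  Imports part 6 (`Theorems.LossEntryW06`, to be landed first).

Contents: §11 virtual states / untranslated chart steps of arbitrary equations / TWIST COMMUTATION, §12 the (a)-prepared equation (`shears_a_eq_swapShear`, `coeff_shears_a_of_degree_eq`, `coeff_shears_a_apex`).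
-/

open MvPolynomial Finset
open Literature.AlgebraicGeometry.Resolution
open Literature.AlgebraicGeometry.Resolution.Hauser2010
open Literature.AlgebraicGeometry.Resolution.PointBlowup
open Summit.ResolutionOfSingularities.ResolutionOfSingularities.Theorems.TightDefectClasses
open Summit.ResolutionOfSingularities.ResolutionOfSingularities.Theorems.TightDefectStrongWalks
open Summit.ResolutionOfSingularities.ResolutionOfSingularities.Theorems.ItineraryCutClasses
open Summit.ResolutionOfSingularities.ResolutionOfSingularities.Theorems.BoundaryLedger
open Summit.ResolutionOfSingularities.ResolutionOfSingularities.Theorems.ProximityCut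
open Summit.ResolutionOfSingularities.ResolutionOfSingularities.Theorems.LossIsFatalLayer (chartMap chartMap_X chartMap_X_self
  chartMap_X_ne chartMap_C)
open Summit.ResolutionOfSingularities.ResolutionOfSingularities.Theorems.LossExitCone
open Summit.ResolutionOfSingularities.ResolutionOfSingularities.Theorems.LossPolygon

/-! ## §11 Virtual (prepared) states: untranslated chart steps and entry sets of arbitrary equations; the twist commutation -/

namespace Summit.ResolutionOfSingularities.ResolutionOfSingularities.Theorems.LossPolygon

variable {K : Type} [Field K] [DecidableEq K]
variable {q : ℕ}

omit [DecidableEq K] in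
/-- The trivial shear. [folklore] -/
theorem shear_zero (c a : Fin 3) (G : MvPolynomial (Fin 3) K) : shear c a 0 G = G := by
  have key : shear (K := K) c a 0 = AlgHom.id K (MvPolynomial (Fin 3) K) := by
    refine MvPolynomial.algHom_ext fun w => ?_
    rw [AlgHom.id_apply, shear_X c a 0 w]
    split_ifs with h
    · rw [h, map_zero, zero_mul, add_zero]
    · rfl
  rw [key, AlgHom.id_apply]

omit [DecidableEq K] in
/-- Two shears of the same type compose additively. [folklore] -/
theorem shear_shear_same {c a : Fin 3} (hca : c ≠ a) (g g' : K) (G : MvPolynomial (Fin 3) K) :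
    shear c a g (shear c a g' G) = shear c a (g' + g) G := by
  have key : (shear (K := K) c a g).comp (shear c a g') = shear c a (g' + g) := by
    refine MvPolynomial.algHom_ext fun w => ?_
    rw [AlgHom.comp_apply, shear_X c a g' w, shear_X c a (g' + g) w]
    split_ifs with h
    · rw [map_add, map_mul, algHom_C, algebraMap_eq, shear_X c a g c, if_pos rfl, shear_X c a g a,
        if_neg (Ne.symm hca), map_add]
      ring
    · rw [shear_X c a g w, if_neg h]
  rw [← AlgHom.comp_apply, key]

/-- `chartExponent` (chart of the third letter `b`) commutes with the shear exponent map of `σ_{c,a}`. [folklore] -/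
theorem shearExp_chartExponent {a b c : Fin 3} (hab : a ≠ b) (hac : a ≠ c) (hbc : b ≠ c) {E : Fin 3 →₀ ℕ} {n : ℕ}
    (hn : n ≤ E c) : shearExp a b c (chartExponent q b E) n = chartExponent q b (shearExp a b c E n) := by
  ext w
  rcases fin3_eq_or a b c w hab hac hbc with h | h | h <;> rw [h]
  · rw [shearExp_apply_fst hab hac, chartExponent_apply, if_neg hab, chartExponent_apply, if_neg hab,
      shearExp_apply_fst hab hac]
  · rw [shearExp_apply_snd hab hbc, chartExponent_apply, if_pos rfl, chartExponent_apply, if_pos rfl,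
      degree_shearExp hab hac hbc E hn]
  · rw [shearExp_apply_thd hac hbc, chartExponent_apply, if_neg (Ne.symm hbc), chartExponent_apply, if_neg (Ne.symm hbc),
      shearExp_apply_thd hac hbc]

omit [DecidableEq K] in
/-- **`Ψ₍₀:₁₎`-LAW FOR A VIRTUAL STATE (PROVED):** the untranslated chart of the second frame letter `b` applied to ANY equation
`H` with monomials of degree `≥ q` maps the point set of `clean H` by `Ψ₍₀:₁₎` (wall bookkeeping as in `polyPts_succ_chart_snd`).
[CJS2020 Lemma 12.2; new in this generality] -/
theorem polyPts_clean_chart_snd {a b c : Fin 3} (hab : a ≠ b) (hac : a ≠ c) (hbc : b ≠ c) {s : ℕ} {r r' : Fin 3 →₀ ℕ}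
    (hra : r' a = r a) (hrb : r' b + q = s + r a + r b) (hrc : r c = 0) (hrc' : r' c = 0)
    {H : MvPolynomial (Fin 3) K} (hH : ∀ E ∈ H.support, q ≤ E.degree) :
    polyPts s r' a b c (deletePthPowers q (chartTransform q b H)) = (polyPts s r a b c (deletePthPowers q H)).image psi01 := by
  classical
  unfold polyPts
  rw [support_deletePthPowers_chartTransform b H hH, support_deletePthPowers', Finset.filter_image, Finset.image_image,
    Finset.image_image]
  have hfilt : ((H.support.filter fun E => ¬ IsPthPowerExponent q E).filter
      fun D => chartExponent q b D c < s + r' c) =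
      ((H.support.filter fun E => ¬ IsPthPowerExponent q E).filter fun D => D c < s + r c) := by
    refine Finset.filter_congr fun D _ => ?_
    rw [chartExponent_apply, if_neg (Ne.symm hbc), hrc, hrc']
  rw [hfilt]
  refine Finset.image_congr fun D hD => ?_
  have hD := Finset.mem_filter.mp hD
  show resPoint s r' a b c (chartExponent q b D) = psi01 (resPoint s r a b c D)
  have hDc : D c < s := by have h2 := hD.2; rw [hrc, add_zero] at h2; exact h2
  exact resPoint_chartExponent_snd hab hac hbc hra hrb hrc hrc' (hH D (Finset.mem_filter.mp hD.1).1) hDc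

omit [DecidableEq K] in
/-- **ONE-WALL POLYGON = ENTRY SET, FOR A VIRTUAL STATE (PROVED):** if `r₁ = T e_a`, `q + T = o` and every monomial of `H`
has degree `≥ q`, the point set of `clean(chart_a H)` in the frame `(a, b; c)` is the entry set of `clean H` with section
letter `b` and ceiling letter `c`. [new] -/
theorem polyPts_clean_chart_eq_entryPts {a b c : Fin 3} (hab : a ≠ b) (hac : a ≠ c) {s o T : ℕ}
    {r₁ : Fin 3 →₀ ℕ} (hr₁a : r₁ a = T) (hr₁b : r₁ b = 0) (hr₁c : r₁ c = 0) (hoT : q + T = o)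
    {H : MvPolynomial (Fin 3) K} (hH : ∀ E ∈ H.support, q ≤ E.degree) :
    polyPts s r₁ a b c (deletePthPowers q (chartTransform q a H)) = entryPts s o b c (deletePthPowers q H) := by
  classical
  have hsupp := support_deletePthPowers_chartTransform a H hH
  ext x
  simp only [polyPts, entryPts, Finset.mem_image, Finset.mem_filter]
  constructor
  · rintro ⟨D, ⟨hD, hDc⟩, rfl⟩
    rw [hsupp, Finset.mem_image] at hD
    obtain ⟨E, hE, rfl⟩ := hD
    have hqE : q ≤ E.degree := hH E (Finset.mem_filter.mp hE).1
    refine ⟨E, ⟨by rw [support_deletePthPowers']; exact hE, ?_⟩,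
      (resPoint_chartExponent_eq_entryPt hab.symm hac hr₁a hr₁b hr₁c hoT hqE).symm⟩
    rw [chartExponent_apply, if_neg (Ne.symm hac), hr₁c, add_zero] at hDc
    exact hDc
  · rintro ⟨E, ⟨hE, hEc⟩, rfl⟩
    rw [support_deletePthPowers'] at hE
    have hqE : q ≤ E.degree := hH E (Finset.mem_filter.mp hE).1
    refine ⟨chartExponent q a E, ⟨?_, ?_⟩, resPoint_chartExponent_eq_entryPt hab.symm hac hr₁a hr₁b hr₁c hoT hqE⟩
    · rw [hsupp]; exact Finset.mem_image_of_mem _ hE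
    · rw [chartExponent_apply, if_neg (Ne.symm hac), hr₁c, add_zero]; exact hEc

omit [DecidableEq K] in
/-- **TWIST COMMUTATION (PROVED):** for a shear `σ_{c,a,g}` not involving the chart letter `b`, shearing the cleaned chart
transform and cleaning again equals cleaning the chart transform of the sheared equation:
`clean(σ(clean(chart_b H))) = clean(chart_b(σ H))`.  (The shear commutes with the chart on exponents; a `q`-th power
monomial of `H` contributes to `σ H` only `q`-th powers (Lucas), which both sides delete.) [new] -/
theorem deletePthPowers_shear_deletePthPowers_chartTransform {a b c : Fin 3} (hab : a ≠ b) (hac : a ≠ c) (hbc : b ≠ c)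
    (hLucas : ∀ D T : ℕ, q ∣ D → ¬ q ∣ T → ((D.choose T : ℕ) : K) = 0) (g : K) {H : MvPolynomial (Fin 3) K}
    (hH : ∀ E ∈ H.support, q ≤ E.degree) :
    deletePthPowers q (shear c a g (deletePthPowers q (chartTransform q b H))) =
      deletePthPowers q (chartTransform q b (shear c a g H)) := by
  classical
  set S := H.support.filter fun E => ¬ IsPthPowerExponent q E with hS
  have hsuppC : (deletePthPowers q (chartTransform q b H)).support = S.image (chartExponent q b) :=
    support_deletePthPowers_chartTransform b H hH
  have hH' : ∀ E ∈ (shear c a g H).support, q ≤ E.degree := fun E hE =>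
    le_degree_of_mem_support_shear hab hac hbc g hH hE
  ext D
  rw [coeff_deletePthPowers, coeff_deletePthPowers]
  by_cases hPD : IsPthPowerExponent q D
  · rw [if_pos hPD, if_pos hPD]
  rw [if_neg hPD, if_neg hPD]
  rw [coeff_shear hab hac hbc g _ D, hsuppC,
    Finset.sum_image (fun E hE E' hE' h => chartExponent_injective_of_le (hH E (Finset.mem_filter.mp hE).1)
      (hH E' (Finset.mem_filter.mp hE').1) h)]
  have hL : ∀ E ∈ S, (∑ n ∈ Finset.range (chartExponent q b E c + 1),
      (if shearExp a b c (chartExponent q b E) n = D then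
        coeff (chartExponent q b E) (deletePthPowers q (chartTransform q b H)) * g ^ n *
          ((chartExponent q b E c).choose n : K) else 0)) =
      ∑ n ∈ Finset.range (E c + 1),
        (if chartExponent q b (shearExp a b c E n) = D then coeff E H * g ^ n * ((E c).choose n : K) else 0) := by
    intro E hE
    obtain ⟨hEH, hEP⟩ := Finset.mem_filter.mp hE
    have hqE := hH E hEH
    have hEc : chartExponent q b E c = E c := by rw [chartExponent_apply, if_neg (Ne.symm hbc)]
    have hcoef : coeff (chartExponent q b E) (deletePthPowers q (chartTransform q b H)) = coeff E H := by
      rw [coeff_deletePthPowers, if_neg (fun h => hEP (isPthPowerExponent_of_chartExponent hqE h)),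
        coeff_chartTransform_chartExponent H hH hEH]
    rw [hEc, hcoef]
    refine Finset.sum_congr rfl fun n hn => ?_
    rw [shearExp_chartExponent hab hac hbc (Nat.lt_succ_iff.mp (Finset.mem_range.mp hn))]
  rw [Finset.sum_congr rfl hL]
  by_cases hex : ∃ E₀ : Fin 3 →₀ ℕ, q ≤ E₀.degree ∧ chartExponent q b E₀ = D
  · obtain ⟨E₀, hqE₀, rfl⟩ := hex
    have hR : coeff (chartExponent q b E₀) (chartTransform q b (shear c a g H)) = coeff E₀ (shear c a g H) := by
      by_cases hE₀ : E₀ ∈ (shear c a g H).support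
      · exact coeff_chartTransform_chartExponent _ hH' hE₀
      · rw [notMem_support_iff.mp hE₀]
        unfold chartTransform
        rw [coeff_sum]
        refine Finset.sum_eq_zero fun E hE => ?_
        rw [coeff_monomial, if_neg]
        intro h
        exact hE₀ ((chartExponent_injective_of_le (hH' E hE) hqE₀ h) ▸ hE)
    rw [hR, coeff_shear hab hac hbc g H E₀, hS, Finset.sum_filter]
    refine Finset.sum_congr rfl fun E hEH => ?_
    have hqE := hH E hEH
    by_cases hEP : IsPthPowerExponent q E
    · rw [if_neg (not_not.mpr hEP)]
      symm
      refine Finset.sum_eq_zero fun n hn => ?_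
      have hn : n ≤ E c := Nat.lt_succ_iff.mp (Finset.mem_range.mp hn)
      split_ifs with hEn
      · by_cases hqn : q ∣ n
        · exfalso
          apply hPD
          rw [← hEn]
          refine isPthPowerExponent_chartExponent ?_
          rw [isPthPowerExponent_iff_of_fin3 hab hac hbc] at hEP ⊢
          obtain ⟨ha, hb, hc⟩ := hEP
          exact ⟨by rw [shearExp_apply_fst hab hac]; exact dvd_add ha hqn, by rwa [shearExp_apply_snd hab hbc],
            by rw [shearExp_apply_thd hac hbc]; exact Nat.dvd_sub hc hqn⟩
        · rw [hLucas (E c) n ((isPthPowerExponent_iff_of_fin3 hab hac hbc E).mp hEP).2.2 hqn, mul_zero]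
      · rfl
    · rw [if_pos hEP]
      refine Finset.sum_congr rfl fun n hn => ?_
      have hn : n ≤ E c := Nat.lt_succ_iff.mp (Finset.mem_range.mp hn)
      by_cases h : shearExp a b c E n = E₀
      · rw [if_pos (by rw [h]), if_pos h]
      · rw [if_neg h, if_neg (fun h' => h (chartExponent_injective_of_le
          (by rw [degree_shearExp hab hac hbc E hn]; exact hqE) hqE₀ h'))]
  · have hR : coeff D (chartTransform q b (shear c a g H)) = 0 := by
      unfold chartTransform
      rw [coeff_sum]
      refine Finset.sum_eq_zero fun E hE => ?_
      rw [coeff_monomial, if_neg]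
      intro h
      exact hex ⟨E, hH' E hE, h⟩
    rw [hR]
    refine Finset.sum_eq_zero fun E hE => Finset.sum_eq_zero fun n hn => ?_
    rw [if_neg]
    intro h
    have hn : n ≤ E c := Nat.lt_succ_iff.mp (Finset.mem_range.mp hn)
    exact hex ⟨_, by rw [degree_shearExp hab hac hbc E hn]; exact hH E (Finset.mem_filter.mp hE).1, h⟩

end Summit.ResolutionOfSingularities.ResolutionOfSingularities.Theorems.LossPolygon

/-! ## §12 The (a)-presentation: prepared equation `σ_{l,j,λ} σ_{j,i,β} σ_{l,i,λβ} F`, its degree-`o` part and its apex -/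

namespace Summit.ResolutionOfSingularities.ResolutionOfSingularities.Theorems.LossPolygon

variable {K : Type} [Field K] [DecidableEq K]
variable {q : ℕ}

omit [DecidableEq K] in
/-- Coefficients of the chart transform at chart exponents, for ANY exponent of degree `≥ q` (zero on both sides off the
support). [folklore] -/
theorem coeff_chartTransform_chartExponent_of_le {b : Fin 3} {G : MvPolynomial (Fin 3) K} (hG : ∀ E ∈ G.support, q ≤ E.degree)
    {B : Fin 3 →₀ ℕ} (hB : q ≤ B.degree) : coeff (chartExponent q b B) (chartTransform q b G) = coeff B G := by
  classical
  by_cases hBG : B ∈ G.support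
  · exact coeff_chartTransform_chartExponent _ hG hBG
  · rw [notMem_support_iff.mp hBG]
    unfold chartTransform
    rw [coeff_sum]
    refine Finset.sum_eq_zero fun E hE => ?_
    rw [coeff_monomial, if_neg]
    intro h
    exact hBG ((chartExponent_injective_of_le (hG E hE) hB h) ▸ hE)

section PencilA

variable {i j l : Fin 3}

omit [DecidableEq K] in
/-- **THE (a)-PREPARATION IS A SWAP OF THE (b)-PREPARATION (PROVED):** for `φ β = 1`,
`σ_{l,j,λ} σ_{j,i,β} σ_{l,i,λβ} F = swapShear_{i,j,φ,β} (σ_{i,j,φ} σ_{l,j,λ} F)`. [new; elementary] -/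
theorem shears_a_eq_swapShear (hij : i ≠ j) (hil : i ≠ l) (hjl : j ≠ l) {φ β : K} (hφβ : φ * β = 1) (lam : K)
    (F : MvPolynomial (Fin 3) K) :
    shear l j lam (shear j i β (shear l i (lam * β) F)) = swapShear i j φ β (shear i j φ (shear l j lam F)) := by
  have key : ((shear (K := K) l j lam).comp (shear j i β)).comp (shear l i (lam * β)) =
      ((swapShear i j φ β).comp (shear i j φ)).comp (shear l j lam) := by
    refine MvPolynomial.algHom_ext fun w => ?_
    rw [AlgHom.comp_apply, AlgHom.comp_apply, AlgHom.comp_apply, AlgHom.comp_apply]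
    rcases fin3_eq_or i j l w hij hil hjl with h | h | h <;> rw [h]
    · rw [shear_X l i _ i, if_neg hil, shear_X j i β i, if_neg hij, shear_X l j lam i, if_neg hil,
        shear_X i j φ i, if_pos rfl, map_add, map_mul (swapShear i j φ β), algHom_C, algebraMap_eq,
        swapShear_X i j φ β i, if_pos rfl, swapShear_X i j φ β j, if_neg (Ne.symm hij), if_pos rfl, map_neg]
      calc (X i : MvPolynomial (Fin 3) K) = C (φ * β) * X i := by rw [hφβ, C_1, one_mul]
        _ = _ := by rw [map_mul]; ring
    · rw [shear_X l i _ j, if_neg hjl, shear_X j i β j, if_pos rfl, map_add, map_mul (shear l j lam), algHom_C,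
        algebraMap_eq, shear_X l j lam j, if_neg hjl, shear_X l j lam i, if_neg hil, shear_X i j φ j, if_neg (Ne.symm hij),
        swapShear_X i j φ β j, if_neg (Ne.symm hij), if_pos rfl]
    · rw [shear_X l i _ l, if_pos rfl, map_add, map_mul (shear j i β), algHom_C, algebraMap_eq, shear_X j i β l,
        if_neg (Ne.symm hjl), shear_X j i β i, if_neg hij, map_add, map_mul (shear l j lam), algHom_C, algebraMap_eq,
        shear_X l j lam l, if_pos rfl, shear_X l j lam i, if_neg hil,
        map_add, map_mul (shear i j φ), algHom_C, algebraMap_eq, shear_X i j φ l, if_neg (Ne.symm hil), shear_X i j φ j,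
        if_neg (Ne.symm hij), map_add, map_mul (swapShear i j φ β), algHom_C, algebraMap_eq, swapShear_X i j φ β l,
        if_neg (Ne.symm hil), if_neg (Ne.symm hjl), swapShear_X i j φ β j, if_neg (Ne.symm hij), if_pos rfl, map_mul]
      ring
  have h := congrArg (fun f : MvPolynomial (Fin 3) K →ₐ[K] MvPolynomial (Fin 3) K => f F) key
  simpa only [AlgHom.comp_apply] using h

omit [DecidableEq K] in
/-- **DEGREE-`o` PART OF THE (a)-PREPARED EQUATION (PROVED):** with the run-state pencil
`F ≡ φ₀ u^r (u_l − λ u_j)^s (mod wall-divisible terms of higher degree)`, the degree-`o` part of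
`σ_{l,j,λ} σ_{j,i,β} σ_{l,i,λβ} F` is `σ_{j,i,β}(φ₀ u^r) · u_l^s = φ₀ u_i^{r_i} (u_j + β u_i)^{r_j} u_l^s`. [new] -/
theorem coeff_shears_a_of_degree_eq (hij : i ≠ j) (hil : i ≠ l) (hjl : j ≠ l) {s o : ℕ} {r : Fin 3 →₀ ℕ} (hrl : r l = 0)
    (hro : r.degree + s = o) (φ₀ lam β : K) {F : MvPolynomial (Fin 3) K} (hwall : ∀ D ∈ F.support, r ≤ D)
    (hpen : ∀ E : Fin 3 →₀ ℕ, E.degree = s → coeff (r + E) F = φ₀ * coeff E ((X l - C lam * X j) ^ s))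
    {D : Fin 3 →₀ ℕ} (hD : D.degree = o) :
    coeff D (shear l j lam (shear j i β (shear l i (lam * β) F))) = coeff D (shear j i β (monomial r φ₀) * X l ^ s) := by
  classical
  set P : MvPolynomial (Fin 3) K := monomial r φ₀ * (X l - C lam * X j) ^ s with hP
  have hFP : ∀ D : Fin 3 →₀ ℕ, D.degree = o → coeff D F = coeff D P := by
    intro D hD
    rw [hP, coeff_monomial_mul']
    by_cases hrD : r ≤ D
    · rw [if_pos hrD]
      have hE : (D - r).degree = s := by
        have h1 : r + (D - r) = D := add_tsub_cancel_of_le hrD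
        have h2 := congrArg Finsupp.degree h1
        rw [map_add, hD] at h2
        omega
      rw [← hpen (D - r) hE, add_tsub_cancel_of_le hrD]
    · rw [if_neg hrD]
      by_contra hne
      exact hrD (hwall D (mem_support_iff.mpr hne))
  have h1 : ∀ D : Fin 3 →₀ ℕ, D.degree = o → coeff D (shear l i (lam * β) F) = coeff D (shear l i (lam * β) P) :=
    fun D hD => coeff_shear_congr_degree l i (lam * β) hFP hD
  have h2 : ∀ D : Fin 3 →₀ ℕ, D.degree = o →
      coeff D (shear j i β (shear l i (lam * β) F)) = coeff D (shear j i β (shear l i (lam * β) P)) :=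
    fun D hD => coeff_shear_congr_degree j i β h1 hD
  rw [coeff_shear_congr_degree l j lam h2 hD]
  -- the three shears of `P`
  have e1 : shear l i (lam * β) (monomial r φ₀) = monomial r φ₀ := by
    rw [shear_monomial hij hil hjl (lam * β) r φ₀, hrl, zero_add, Finset.sum_range_one, shearExp_zero hij hil hjl, pow_zero,
      mul_one, Nat.choose_zero_right, Nat.cast_one, mul_one]
  have e2 : shear l i (lam * β) (X l - C lam * X j) = X l + C (lam * β) * X i - C lam * X j := by
    rw [map_sub, map_mul, algHom_C, algebraMap_eq, shear_X l i _ l, if_pos rfl, shear_X l i _ j, if_neg hjl]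
  have e3 : shear j i β (X l + C (lam * β) * X i - C lam * X j) = X l - C lam * X j := by
    rw [map_sub, map_add, map_mul (shear j i β), map_mul (shear j i β), algHom_C, algHom_C, algebraMap_eq, shear_X j i β l,
      if_neg (Ne.symm hjl), shear_X j i β i, if_neg hij, shear_X j i β j, if_pos rfl, map_mul]
    ring
  have e4 : shear l j lam (X l - C lam * X j) = X l := by
    rw [map_sub, map_mul, shear_X, shear_X, if_pos rfl, if_neg hjl, algHom_C, algebraMap_eq]; ring
  have e5 : shear l j lam (shear j i β (monomial r φ₀)) = shear j i β (monomial r φ₀) := by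
    rw [shear_monomial hil hij hjl.symm β r φ₀, map_sum]
    refine Finset.sum_congr rfl fun n _ => ?_
    have hDl : shearExp i l j r n l = 0 := by rw [shearExp_apply_snd hil hjl.symm, hrl]
    rw [shear_monomial hij.symm hjl hil lam, hDl, zero_add, Finset.sum_range_one, shearExp_zero hij.symm hjl hil, pow_zero,
      mul_one, Nat.choose_zero_right, Nat.cast_one, mul_one]
  rw [hP, map_mul, map_pow, e1, e2, map_mul, map_pow, e3, map_mul, map_pow, e4, e5]

omit [DecidableEq K] in
/-- **APEX OF THE (a)-PRESENTATION UNDER A FURTHER SHEAR `σ_{l,j,ε}` (PROVED):** the coefficient of `u_i^{r_i + r_j} u_j^s` in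
`σ_{l,j,ε}` of the prepared equation is `φ₀ β^{r_j} ε^s` (the wall `u_j^{r_j}` fully converted into `u_i`, the ceiling `u_l^s`
fully converted into `u_j`). For `ε = μ − λ` this is the coefficient that FORCES the translation `b_l = λ` at the next step. [new] -/
theorem coeff_shears_a_apex (hij : i ≠ j) (hil : i ≠ l) (hjl : j ≠ l) {s o : ℕ} {r : Fin 3 →₀ ℕ} (hrl : r l = 0)
    (hro : r.degree + s = o) (φ₀ lam β ε : K) {F : MvPolynomial (Fin 3) K} (hwall : ∀ D ∈ F.support, r ≤ D)
    (hpen : ∀ E : Fin 3 →₀ ℕ, E.degree = s → coeff (r + E) F = φ₀ * coeff E ((X l - C lam * X j) ^ s)) :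
    coeff (Finsupp.single i (r i + r j) + Finsupp.single j s) (shear l j ε (shear l j lam (shear j i β (shear l i (lam * β) F)))) =
      φ₀ * β ^ (r j) * ε ^ s := by
  classical
  have hBdeg : (Finsupp.single i (r i + r j) + Finsupp.single j s : Fin 3 →₀ ℕ).degree = o := by
    rw [map_add, Finsupp.degree_single, Finsupp.degree_single, ← hro, degree_fin3 hij hil hjl r, hrl, add_zero]
  rw [coeff_shear_congr_degree l j ε (fun D hD => coeff_shears_a_of_degree_eq hij hil hjl hrl hro φ₀ lam β hwall hpen hD) hBdeg]
  -- `σ_{j,i,β}(φ₀ u^r) · u_l^s` as a sum of monomials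
  have hsum : shear j i β (monomial r φ₀) * X l ^ s =
      ∑ n ∈ Finset.range (r j + 1), monomial (shearExp i l j r n + Finsupp.single l s) (φ₀ * β ^ n * ((r j).choose n : K)) := by
    rw [shear_monomial hil hij hjl.symm β r φ₀, Finset.sum_mul]
    refine Finset.sum_congr rfl fun n _ => ?_
    rw [X_pow_eq_monomial, monomial_mul, mul_one]
  have hri' : ∀ n, shearExp i l j r n i = r i + n := fun n => shearExp_apply_fst hil hij r n
  have hrl' : ∀ n, shearExp i l j r n l = 0 := fun n => by rw [shearExp_apply_snd hil hjl.symm, hrl]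
  have hrj' : ∀ n, shearExp i l j r n j = r j - n := fun n => shearExp_apply_thd hij hjl.symm r n
  have hDl : ∀ n, (shearExp i l j r n + Finsupp.single l s) l = s := fun n => by
    rw [Finsupp.add_apply, hrl', Finsupp.single_eq_same, zero_add]
  rw [hsum, map_sum, coeff_sum, Finset.sum_eq_single (r j)]
  · rw [shear_monomial hij.symm hjl hil ε _ _, coeff_sum, hDl, Finset.sum_eq_single s]
    · rw [coeff_monomial, if_pos]
      · rw [Nat.choose_self, Nat.choose_self, Nat.cast_one, mul_one, mul_one]
      · ext w
        rcases fin3_eq_or i j l w hij hil hjl with h | h | h <;> rw [h]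
        · rw [shearExp_apply_snd hij.symm hil, Finsupp.add_apply, hri', Finsupp.single_apply, if_neg (Ne.symm hil)]
          simp [hij]
        · rw [shearExp_apply_fst hij.symm hjl, Finsupp.add_apply, hrj', Finsupp.single_apply, if_neg (Ne.symm hjl), Nat.sub_self]
          simp [Ne.symm hij]
        · rw [shearExp_apply_thd hjl hil, hDl, Nat.sub_self]
          simp [Ne.symm hil, Ne.symm hjl]
    · intro n' hn' hne
      rw [coeff_monomial, if_neg]
      intro h
      have h1 := congrArg (fun D : Fin 3 →₀ ℕ => D l) h
      rw [shearExp_apply_thd hjl hil, hDl, Finsupp.add_apply, Finsupp.single_apply, if_neg hil, Finsupp.single_apply,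
        if_neg hjl] at h1
      have hn2 : n' ≤ s := Nat.lt_succ_iff.mp (Finset.mem_range.mp hn')
      omega
    · intro h; exact absurd (Finset.mem_range.mpr (Nat.lt_succ_self _)) h
  · intro n hn hne
    rw [shear_monomial hij.symm hjl hil ε _ _, coeff_sum]
    refine Finset.sum_eq_zero fun n' _ => ?_
    rw [coeff_monomial, if_neg]
    intro h
    have h1 := congrArg (fun D : Fin 3 →₀ ℕ => D i) h
    rw [shearExp_apply_snd hij.symm hil, Finsupp.add_apply, hri', Finsupp.single_apply, if_neg (Ne.symm hil),
      Finsupp.add_apply, Finsupp.single_eq_same, Finsupp.single_apply, if_neg (Ne.symm hij)] at h1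
    have hn2 : n ≤ r j := Nat.lt_succ_iff.mp (Finset.mem_range.mp hn)
    omega
  · intro h; exact absurd (Finset.mem_range.mpr (Nat.lt_succ_self _)) h

end PencilA

end Summit.ResolutionOfSingularities.ResolutionOfSingularities.Theorems.LossPolygon
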